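import Literature.MathematicalPhysics.QuantumFieldTheory.Balaban1983to89.B2Eq228Conditioning
import HarnessLib

/-!
# Dimock, *Quantum electrodynamics on the 3-torus I*, Appendix C «spacetime split», LEMMA 23 with (320)–(323) —
# bosonic conditional integration over `R^Λ`:
# `∫_{R^S} H(A_{Λᶜ}) F(A) e^{−½(A,TA)} dA = ∫_{R^S} H(A_{Λᶜ}) F̃(A_{Λᶜ}) e^{−½(A,TA)} dA`, `F̃(A_{Λᶜ}) = ∫_{R^Λ} F(A) dμ_{C_Λ,α_Λ}(A_Λ)`
# — PROVED (finite-dimensional Lebesgue integrals; the conditioning carrier of [Balaban1982Higgs2] (2.28) REUSED)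

statement-level skeleton of published theorems with citation tags; proofs where landed; nothing here is a claim about the Yang–Mills mass gap

**Citation header (reproduction of PUBLISHED work).** J. Dimock, *Quantum electrodynamics on the 3-torus. I. First
step*, arXiv:math-ph/0210020 (2002) [Dimock2002QED3TorusI], **Appendix C** «spacetime split», p.65 L1–61 of the arXiv-v1
text layer `paper:arxiv-math-ph_0210020` (`p.NN Lnn` = PDF page ∕ text-layer line). Writer seat p11
(literature-prover-lit-balaban-p11-g16-0), YM LIT SWEEP item (c) D12; sibling of `QED3SpacetimeSplit.lean` (LEMMA 24, the
fermionic statement). The finite-dimensional conditional Gaussian integration used here is the tree's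
`Balaban1983to89.B2Eq228Conditioning` (T. Bałaban, CMP **86** (1982) (2.28) p.563, seat p15) — REUSED, nothing re-declared:
configurations `glue`∕`resIn`∕`resOut`, blocks `blkIn`∕`blkMix`∕`blkMix'`∕`blkOut`, the weight `e^{−½⟨φ,Aφ⟩}` (`weight`),
the probabilistic Gaussian measure `dμ_{M⁻¹}` (`gaussProb`), the shift `condShift`, the `Λ`-integration at fixed exterior
field (`integral_section`) and the Fubini∕domination bookkeeping; Dimock's LEMMA 23 is Bałaban's (2.28) at source `f = 0`
for a function `F(A)` of the WHOLE field (there: `F(φ↾_Λ)G(φ↾_{Λᶜ})`).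

**The printed text (p.65 L1–61).** *"Let `S` be a finite set (e.g. one of our tori) and let `Λ` be a subset (e.g. a
small field region). Suppose we have a Gaussian integral on `R^S` defined by a positive self-adjoint operator `T` on
`R^S`. We want to carry out the integral over `R^Λ` first. This is accomplished by:* **LEMMA 23**
`∫_{R^S} H(A_{Λᶜ}) F(A) exp(−½(A,TA)) dA = ∫_{R^S} H(A_{Λᶜ}) F̃(A_{Λᶜ}) exp(−½(A,TA)) dA` (320) *where
`F̃(A_{Λᶜ}) = ∫_{R^Λ} F(A) dμ_{C_Λ,α_Λ}(A_Λ)` (321) and `μ_{C_Λ,α_Λ}` is the Gaussian measure with covariance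
`C_Λ = T_Λ⁻¹` and mean `α_Λ = −T_Λ⁻¹ T_{ΛΛᶜ} A_{Λᶜ}`. Remark. `F̃(A_{Λᶜ})` is the conditional expectation of `F(A)`
with respect to the variables `A_{Λᶜ}`. Proof. In `(A,TA)` we write `T = T_{Λᶜ} + T_{ΛᶜΛ} + T_{ΛΛᶜ} + T_Λ` where
`T_{ΛᶜΛ} = χ_{Λᶜ}Tχ_Λ`, etc. The cross terms are eliminated by the transformation `A_Λ → A_Λ + α_Λ`, `A_{Λᶜ} → A_{Λᶜ}`
which we also write as `A → A + α_Λ`. Then the left side of (320) becomes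
`∫ dA_{Λᶜ} H(A_{Λᶜ}) exp(−½(A,R_{Λᶜ}A)) (∫ F(A + α_Λ) exp(−½(A,T_ΛA)) dA_Λ)` (322) where
`R_{Λᶜ} = T_{Λᶜ} − T_{ΛᶜΛ}T_Λ⁻¹T_{ΛΛᶜ}`. If we divide by `∫exp(−(Φ,T_ΛΦ))dΦ_Λ` the term in parentheses is
identified as `F̃(A_{Λᶜ})` and we have `∫ dA_{Λᶜ} H(A_{Λᶜ}) F̃(A_{Λᶜ}) exp(−½(A,R_{Λᶜ}A)) (∫ exp(−½(A,T_ΛA)) dA_Λ)`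
(323). Now reverse the first step to get the right side of (320). This completes the proof."*

**The model (exactly the printed generality).** `S` ↦ a finite type `S`; `Λ ⊂ S` ↦ a decidable predicate `p`
(`R^Λ = In p → ℝ`, `R^{Λᶜ} = Out p → ℝ`, `A = glue p A_Λ A_{Λᶜ}`, `A_{Λᶜ} = resOut p A`); `dA` = Lebesgue measure `volume`
on `S → ℝ`; `T : Matrix S S ℝ` positive definite (*"positive self-adjoint"*), `T_Λ = blkIn p T`, `T_{ΛΛᶜ} = blkMix p T`,
`T_{ΛᶜΛ} = blkMix' p T`, `T_{Λᶜ} = blkOut p T`; `exp(−½(A,TA)) = weight T A`; `H : (Out p → ℝ) → ℝ`, `F : (S → ℝ) → ℝ`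
measurable with the left side of (320) absolutely convergent (the identity is between Lebesgue integrals; Mathlib's
`∫` of a non-integrable function is `0`).
* `meanΛ p T A_{Λᶜ} = α_Λ = −T_Λ⁻¹T_{ΛΛᶜ}A_{Λᶜ}` (= the tree's `condShift p T 0`, `meanΛ_eq_condShift`); `schurC p T = R_{Λᶜ}`;
* `gaussMeasure M α = μ_{M⁻¹,α}` — the Gaussian probability measure with covariance `M⁻¹` and mean `α` (the translate
  by `α` of the tree's `gaussProb M = dμ_{M⁻¹}`; `integral_gaussMeasure`, `isProbabilityMeasure_gaussMeasure`);
* **`condExp p T F = F̃` DEFINED BY (321)**, with `condExp_eq_inner` (= the tree's `B2Eq228Conditioning.inner` at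
  source `0` applied to `A_Λ ↦ F(A_Λ ⊕ A_{Λᶜ})`) and `condExp_eq_integral` (= (322)∕(323):
  `F̃ = [∫e^{−½(Φ,T_ΛΦ)}dΦ_Λ]⁻¹ ∫ F(A + α_Λ) e^{−½(A_Λ,T_ΛA_Λ)} dA_Λ`);
* `secConst_zero_eq_schurC` — the exterior factor of (322) is `exp(−½(A_{Λᶜ}, R_{Λᶜ}A_{Λᶜ}))`;
  `integral_section_eq` — **(322)** at fixed `A_{Λᶜ}`: `∫ dA_Λ H F e^{−½(A,TA)} = H(A_{Λᶜ}) e^{−½(A_{Λᶜ},R_{Λᶜ}A_{Λᶜ})}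
  ∫ F(A + α_Λ) e^{−½(A_Λ,T_ΛA_Λ)} dA_Λ`; `integral_section_eq_condExp` — **(323)**;
* `integrable_rhs` — absolute convergence of the right side of (320) follows from that of the left side;
* **`lemma23` — (320) as printed.**
Not here: the Remark as a statement about Mathlib's `MeasureTheory.condExp` (prose only); LEMMA 24 (sibling file).
-/

noncomputable section

open MeasureTheory Matrix Finset
open scoped BigOperators ENNReal

namespace Literature.MathematicalPhysics.QuantumFieldTheory.Dimock2011to13

namespace QED3TorusI

namespace SpacetimeSplitBosons

open Literature.MathematicalPhysics.QuantumFieldTheory.Balaban1983to89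
open Literature.MathematicalPhysics.QuantumFieldTheory.Balaban1983to89.B13GaugeDevices (gaussWeight gaussInt gaussNorm)
open Literature.MathematicalPhysics.QuantumFieldTheory.Balaban1983to89.B2Eq228Conditioning

variable {S : Type} [Fintype S] [DecidableEq S] (p : S → Prop) [DecidablePred p]

/-! ## The Gaussian measure with covariance `M⁻¹` and mean `α` -/

section GaussMeasure

variable {ι : Type} [Fintype ι]

/-- **`μ_{M⁻¹,α}`**: the Gaussian probability measure on `ι → ℝ` with covariance `M⁻¹` and mean `α` — the translate by
`α` of the tree's `dμ_{M⁻¹} = gaussProb M` (density `exp(−½⟨x−α, M(x−α)⟩)` normalised). Print: *"`μ_{C_Λ,α_Λ}` is the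
Gaussian measure with covariance `C_Λ = T_Λ⁻¹` and mean `α_Λ`"*. [cite: Dimock2002QED3TorusI, App. C (321) p.65 L26–30] -/
def gaussMeasure (M : Matrix ι ι ℝ) (α : ι → ℝ) : Measure (ι → ℝ) :=
  (gaussProb M).map fun x => x + α

/-- Integration against `μ_{M⁻¹,α}`: `∫ g dμ_{M⁻¹,α} = ∫ g(x + α) dμ_{M⁻¹}(x)` (no hypothesis on `g`).
[cite: Dimock2002QED3TorusI, App. C (321)–(322) p.65 L26–48] -/
theorem integral_gaussMeasure (M : Matrix ι ι ℝ) (α : ι → ℝ) (g : (ι → ℝ) → ℝ) :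
    ∫ x, g x ∂(gaussMeasure M α) = ∫ x, g (x + α) ∂(gaussProb M) := by
  rw [gaussMeasure, show (fun x : ι → ℝ => x + α) = ⇑(MeasurableEquiv.addRight α) from rfl,
    integral_map_equiv]
  rfl

/-- `μ_{M⁻¹,α}` is a probability measure (`M` positive definite). [cite: Dimock2002QED3TorusI, App. C (321) p.65 L26–30] -/
theorem isProbabilityMeasure_gaussMeasure [DecidableEq ι] {M : Matrix ι ι ℝ} (hM : M.PosDef) (α : ι → ℝ) :
    IsProbabilityMeasure (gaussMeasure M α) := by
  haveI := isProbabilityMeasure_gaussProb hM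
  exact Measure.isProbabilityMeasure_map (measurable_add_const α).aemeasurable

end GaussMeasure

/-! ## `α_Λ`, `R_{Λᶜ}` and `F̃` -/

section CondExp

variable (T : Matrix S S ℝ)

/-- **The mean `α_Λ = −T_Λ⁻¹ T_{ΛΛᶜ} A_{Λᶜ}`** of the conditional Gaussian measure, as a function of the exterior field
`A_{Λᶜ}`. [cite: Dimock2002QED3TorusI, App. C (321) p.65 L28–30] -/
def meanΛ (y : Out p → ℝ) : In p → ℝ :=
  -((blkIn p T)⁻¹ *ᵥ (blkMix p T *ᵥ y))

/-- **`R_{Λᶜ} = T_{Λᶜ} − T_{ΛᶜΛ} T_Λ⁻¹ T_{ΛΛᶜ}`** (the Schur complement). [cite: Dimock2002QED3TorusI, App. C (322) p.65 L52–53] -/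
def schurC : Matrix (Out p) (Out p) ℝ :=
  blkOut p T - blkMix' p T * (blkIn p T)⁻¹ * blkMix p T

/-- `α_Λ` is the tree's conditional shift of [Balaban1982Higgs2] (2.28) at source `f = 0`:
`−T_Λ⁻¹T_{ΛΛᶜ}A_{Λᶜ} = T_Λ⁻¹(0 − T_{ΛΛᶜ}A_{Λᶜ})`. [cite: Dimock2002QED3TorusI, App. C (321) p.65 L28–30] -/
theorem meanΛ_eq_condShift (y : Out p → ℝ) : meanΛ p T y = condShift p T 0 y := by
  have h0 : resIn p (0 : S → ℝ) = 0 := rfl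
  simp only [meanΛ, condShift, h0, zero_sub, mulVec_neg]

/-- **`F̃(A_{Λᶜ}) = ∫_{R^Λ} F(A) dμ_{C_Λ,α_Λ}(A_Λ)` (321)**, `A = A_Λ ⊕ A_{Λᶜ}`, `C_Λ = T_Λ⁻¹`,
`α_Λ = −T_Λ⁻¹T_{ΛΛᶜ}A_{Λᶜ}`. [cite: Dimock2002QED3TorusI, App. C (321) p.65 L24–30] -/
def condExp (F : (S → ℝ) → ℝ) (y : Out p → ℝ) : ℝ :=
  ∫ x, F (glue p x y) ∂(gaussMeasure (blkIn p T) (meanΛ p T y))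

/-- `F̃` is the tree's inner integral of (2.28) at source `0`, applied to `A_Λ ↦ F(A_Λ ⊕ A_{Λᶜ})`:
`F̃(A_{Λᶜ}) = ∫ dμ_{T_Λ⁻¹}(A′) F((A′ + α_Λ) ⊕ A_{Λᶜ})`. [cite: Dimock2002QED3TorusI, App. C (321)–(322) p.65 L24–48] -/
theorem condExp_eq_inner (F : (S → ℝ) → ℝ) (y : Out p → ℝ) :
    condExp p T F y = B2Eq228Conditioning.inner p T 0 (fun x => F (glue p x y)) y := by
  rw [condExp, meanΛ_eq_condShift, integral_gaussMeasure, B2Eq228Conditioning.inner]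


/-- **(322)∕(323): `F̃` as the normalised `Λ`-integral of the shifted function** — *"If we divide by
`∫exp(−(Φ,T_ΛΦ))dΦ_Λ` the term in parentheses is identified as `F̃(A_{Λᶜ})`"*:
`F̃(A_{Λᶜ}) = [∫ e^{−½(Φ,T_ΛΦ)} dΦ_Λ]⁻¹ ∫ F((A_Λ + α_Λ) ⊕ A_{Λᶜ}) e^{−½(A_Λ,T_ΛA_Λ)} dA_Λ`.
[cite: Dimock2002QED3TorusI, App. C (322)–(323) p.65 L42–60] -/
theorem condExp_eq_integral (F : (S → ℝ) → ℝ) (y : Out p → ℝ) :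
    condExp p T F y = (gaussNorm (blkIn p T))⁻¹ *
      ∫ z, gaussWeight (blkIn p T) z * F (glue p (z + meanΛ p T y) y) := by
  rw [condExp_eq_inner, B2Eq228Conditioning.inner_eq]
  simp only [meanΛ_eq_condShift]


/-- `F̃` is linear over the functions of the exterior field: `(H(A_{Λᶜ})F)~ = H F̃` (the conditional-expectation property of
the Remark). [cite: Dimock2002QED3TorusI, App. C p.65 L33–34 («F̃(A_{Λᶜ}) is the conditional expectation of F(A) …»)] -/
theorem condExp_mul_left (H : (Out p → ℝ) → ℝ) (F : (S → ℝ) → ℝ) (y : Out p → ℝ) :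
    condExp p T (fun A => H (resOut p A) * F A) y = H y * condExp p T F y := by
  simp only [condExp, resOut_glue, integral_const_mul]

/-- `1̃ = 1` (`T_Λ` positive definite). [cite: Dimock2002QED3TorusI, App. C (321) p.65 L24–30] -/
theorem condExp_one (hT : (blkIn p T).PosDef) (y : Out p → ℝ) : condExp p T (fun _ => 1) y = 1 := by
  haveI := isProbabilityMeasure_gaussMeasure hT (meanΛ p T y)
  rw [condExp, integral_const, smul_eq_mul, mul_one, probReal_univ]

end CondExp

/-! ## (322): the `Λ`-integration at fixed exterior field -/

section Section322

variable (T : Matrix S S ℝ)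

/-- The exterior factor of (322): for symmetric `T`, the tree's section constant of (2.28) at source `0` is
`exp(−½(A_{Λᶜ}, R_{Λᶜ}A_{Λᶜ}))`, `R_{Λᶜ} = T_{Λᶜ} − T_{ΛᶜΛ}T_Λ⁻¹T_{ΛΛᶜ}`. [cite: Dimock2002QED3TorusI, App. C (322) p.65 L42–53] -/
theorem secConst_zero_eq_schurC (hT : T.IsSymm) (y : Out p → ℝ) :
    secConst p T 0 y = Real.exp (-(1/2 : ℝ) * (y ⬝ᵥ schurC p T *ᵥ y)) := by
  rw [secConst, cOut, jIn, show resIn p (0 : S → ℝ) = 0 from rfl, show resOut p (0 : S → ℝ) = 0 from rfl, sub_zero,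
    zero_dotProduct, add_zero, ← Real.exp_add, schurC, sub_mulVec, dotProduct_sub, blkMix'_eq_transpose p hT,
    ← mulVec_mulVec, ← mulVec_mulVec, dotProduct_mulVec y (blkMix p T)ᵀ, vecMul_transpose]
  ring_nf

/-- **(322) at fixed exterior field `A_{Λᶜ}`** (no hypothesis on `H`, `F`): for symmetric `T` with `T_Λ` invertible,
`∫ dA_Λ H(A_{Λᶜ}) F(A) e^{−½(A,TA)} = H(A_{Λᶜ}) e^{−½(A_{Λᶜ},R_{Λᶜ}A_{Λᶜ})} ∫ F(A + α_Λ) e^{−½(A_Λ,T_ΛA_Λ)} dA_Λ`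
— *"the cross terms are eliminated by the transformation `A_Λ → A_Λ + α_Λ`"*.
[cite: Dimock2002QED3TorusI, App. C (322) p.65 L36–53] -/
theorem integral_section_eq (hT : T.IsSymm) (hdet : IsUnit (blkIn p T).det) (H : (Out p → ℝ) → ℝ)
    (F : (S → ℝ) → ℝ) (y : Out p → ℝ) :
    ∫ x, H (resOut p (glue p x y)) * F (glue p x y) * weight T (glue p x y) =
      H y * Real.exp (-(1/2 : ℝ) * (y ⬝ᵥ schurC p T *ᵥ y)) *
        ∫ z, gaussWeight (blkIn p T) z * F (glue p (z + meanΛ p T y) y) := by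
  have h := integral_section p T 0 hT hdet y (fun x => F (glue p x y)) (H y)
  have hpt : ∀ x, H (resOut p (glue p x y)) * F (glue p x y) * weight T (glue p x y) =
      weight T (glue p x y) * (source 0 (glue p x y) * F (glue p x y) * H y) := by
    intro x
    rw [resOut_glue, source]
    simp only [Pi.zero_apply, zero_mul, sum_const_zero, Real.exp_zero, one_mul]
    ring
  simp_rw [hpt]
  rw [h, secConst_zero_eq_schurC p T hT]
  simp only [gaussInt, smul_eq_mul, meanΛ_eq_condShift]

/-- **(323) at fixed exterior field**: *"If we divide by `∫exp(−(Φ,T_ΛΦ))dΦ_Λ` the term in parentheses is identified as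
`F̃(A_{Λᶜ})`"* — `∫ dA_Λ H F e^{−½(A,TA)} = H(A_{Λᶜ}) e^{−½(A_{Λᶜ},R_{Λᶜ}A_{Λᶜ})} · F̃(A_{Λᶜ}) · ∫ e^{−½(A_Λ,T_ΛA_Λ)} dA_Λ`.
[cite: Dimock2002QED3TorusI, App. C (323) p.65 L54–60] -/
theorem integral_section_eq_condExp (hT : T.IsSymm) (hdet : IsUnit (blkIn p T).det) (hN : gaussNorm (blkIn p T) ≠ 0)
    (H : (Out p → ℝ) → ℝ) (F : (S → ℝ) → ℝ) (y : Out p → ℝ) :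
    ∫ x, H (resOut p (glue p x y)) * F (glue p x y) * weight T (glue p x y) =
      H y * Real.exp (-(1/2 : ℝ) * (y ⬝ᵥ schurC p T *ᵥ y)) * (condExp p T F y * gaussNorm (blkIn p T)) := by
  rw [integral_section_eq p T hT hdet, condExp_eq_integral, mul_comm ((gaussNorm _)⁻¹) _, mul_assoc (∫ z, _),
    inv_mul_cancel₀ hN, mul_one]

/-- *"Now reverse the first step"*: the `Λ`-integral of the RIGHT side of (320) at fixed exterior field is the same
expression (`F̃(A_{Λᶜ})` does not depend on `A_Λ`, and `∫ dA_Λ e^{−½(A,TA)} = e^{−½(A_{Λᶜ},R_{Λᶜ}A_{Λᶜ})}∫e^{−½(A_Λ,T_ΛA_Λ)}dA_Λ`).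
[cite: Dimock2002QED3TorusI, App. C (323) p.65 L54–61] -/
theorem integral_section_condExp_eq (hT : T.IsSymm) (hdet : IsUnit (blkIn p T).det)
    (H : (Out p → ℝ) → ℝ) (F : (S → ℝ) → ℝ) (y : Out p → ℝ) :
    ∫ x, H (resOut p (glue p x y)) * condExp p T F (resOut p (glue p x y)) * weight T (glue p x y) =
      H y * Real.exp (-(1/2 : ℝ) * (y ⬝ᵥ schurC p T *ᵥ y)) * (condExp p T F y * gaussNorm (blkIn p T)) := by
  have h := integral_section_eq p T hT hdet (fun y' => H y' * condExp p T F y') (fun _ => 1) y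
  simp only [mul_one] at h
  rw [h, gaussNorm]
  ring

end Section322

/-! ## LEMMA 23 -/

section Lemma23

variable (T : Matrix S S ℝ)

omit [Fintype S] [DecidableEq S] [DecidablePred p] in
/-- A positive definite real operator is symmetric. [cite: Dimock2002QED3TorusI, App. C p.65 L3–4 («positive self-adjoint operator T»)] -/
theorem isSymm_of_posDef (hT : T.PosDef) : T.IsSymm := by
  have h := hT.isHermitian.eq
  rwa [conjTranspose_eq_transpose_of_trivial] at h

omit [Fintype S] [DecidableEq S] [DecidablePred p] in
/-- `T_Λ = χ_ΛTχ_Λ` is positive definite with `T`. [cite: Dimock2002QED3TorusI, App. C p.65 L3–4] -/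
theorem blkIn_posDef (hT : T.PosDef) : (blkIn p T).PosDef := by
  unfold blkIn
  exact hT.submatrix Subtype.val_injective

/-- `F̃` is a measurable function of the exterior field (`F` measurable).
[cite: Dimock2002QED3TorusI, App. C (321) p.65 L24–30] -/
theorem measurable_condExp {F : (S → ℝ) → ℝ} (hF : Measurable F) : Measurable (condExp p T F) := by
  have h1 : condExp p T F = fun y => (gaussNorm (blkIn p T))⁻¹ *
      ∫ z, gaussWeight (blkIn p T) z * F (glue p (z + meanΛ p T y) y) := funext fun y => condExp_eq_integral p T F y
  rw [h1]
  refine Measurable.const_mul ?_ _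
  have hmean : Continuous (meanΛ p T) := by unfold meanΛ; fun_prop
  let g : (Out p → ℝ) × (In p → ℝ) → ℝ := fun r => gaussWeight (blkIn p T) r.2 * F (glue p (r.2 + meanΛ p T r.1) r.1)
  have hglue : Measurable fun r : (Out p → ℝ) × (In p → ℝ) => glue p (r.2 + meanΛ p T r.1) r.1 :=
    (measurable_glue p).comp ((measurable_snd.add (hmean.measurable.comp measurable_fst)).prodMk measurable_fst)
  have hg : Measurable g :=
    ((show Measurable (gaussWeight (blkIn p T)) from measurable_gaussWeight_real _).comp measurable_snd).mul
      (hF.comp hglue)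
  exact (hg.stronglyMeasurable.integral_prod_right' (ν := volume)).measurable

/-- `|F̃(A_{Λᶜ})| · ∫e^{−½(Φ,T_ΛΦ)}dΦ_Λ ≤ ∫ |F(A + α_Λ)| e^{−½(A_Λ,T_ΛA_Λ)} dA_Λ`.
[cite: Dimock2002QED3TorusI, App. C (322)–(323) p.65 L42–60] -/
theorem abs_condExp_mul_gaussNorm_le (F : (S → ℝ) → ℝ) (y : Out p → ℝ) (hN : gaussNorm (blkIn p T) ≠ 0) :
    |condExp p T F y| * gaussNorm (blkIn p T) ≤
      gaussInt (blkIn p T) (fun z => |F (glue p (z + meanΛ p T y) y)|) := by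
  have h := abs_inner_mul_gaussNorm_le p T 0 (fun x => F (glue p x y)) y hN
  rw [← condExp_eq_inner] at h
  simpa only [meanΛ_eq_condShift] using h

/-- **Absolute convergence of the right side of (320) from that of the left side** (on pairs `(A_Λ, A_{Λᶜ})`): the
`A_{Λᶜ}`-marginal of `|H F̃ e^{−½(A,TA)}|` is dominated by that of `|H F e^{−½(A,TA)}|`.
[cite: Dimock2002QED3TorusI, App. C (320)–(323) p.65 L6–61] -/
theorem integrable_rhs (hT : T.PosDef) {H : (Out p → ℝ) → ℝ} {F : (S → ℝ) → ℝ}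
    (hH : Measurable H) (hF : Measurable F)
    (hΦ : Integrable (fun q : (In p → ℝ) × (Out p → ℝ) =>
      H (resOut p (glue p q.1 q.2)) * F (glue p q.1 q.2) * weight T (glue p q.1 q.2))) :
    Integrable (fun q : (In p → ℝ) × (Out p → ℝ) =>
      H (resOut p (glue p q.1 q.2)) * condExp p T F (resOut p (glue p q.1 q.2)) * weight T (glue p q.1 q.2)) := by
  have hTs : T.IsSymm := isSymm_of_posDef T hT
  have hIn : (blkIn p T).PosDef := blkIn_posDef p T hT
  have hdet : IsUnit (blkIn p T).det := isUnit_iff_ne_zero.2 hIn.det_pos.ne'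
  have hN : gaussNorm (blkIn p T) ≠ 0 := (gaussNorm_pos hIn).ne'
  -- measurability
  have hgl := measurable_glue p
  have hW : Measurable fun q : (In p → ℝ) × (Out p → ℝ) => weight T (glue p q.1 q.2) :=
    (continuous_weight T).measurable.comp hgl
  have hC : Measurable (condExp p T F) := measurable_condExp p T hF
  have hmeas : AEStronglyMeasurable (fun q : (In p → ℝ) × (Out p → ℝ) =>
      H (resOut p (glue p q.1 q.2)) * condExp p T F (resOut p (glue p q.1 q.2)) * weight T (glue p q.1 q.2)) volume := by
    have h1 : Measurable fun q : (In p → ℝ) × (Out p → ℝ) => H (resOut p (glue p q.1 q.2)) := by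
      simp only [resOut_glue]; exact hH.comp measurable_snd
    have h2 : Measurable fun q : (In p → ℝ) × (Out p → ℝ) => condExp p T F (resOut p (glue p q.1 q.2)) := by
      simp only [resOut_glue]; exact hC.comp measurable_snd
    exact ((h1.mul h2).mul hW).aestronglyMeasurable
  refine (integrable_prod_iff' hmeas).2 ⟨Filter.Eventually.of_forall fun y => ?_, ?_⟩
  · -- sections: a constant times the section weight
    have hsec := integrable_section_const p T 0 hT y (H y) (condExp p T F y)
    refine hsec.congr (Filter.Eventually.of_forall fun x => ?_)
    show weight T (glue p x y) * (source 0 (glue p x y) * H y * condExp p T F y) =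
      H (resOut p (glue p x y)) * condExp p T F (resOut p (glue p x y)) * weight T (glue p x y)
    rw [resOut_glue, source]
    simp only [Pi.zero_apply, zero_mul, sum_const_zero, Real.exp_zero, one_mul]
    ring
  · -- the y-integral of the x-norm-integral is dominated by that of the left-side integrand
    have hdom := hΦ.integral_norm_prod_right
    have hclosed : ∀ y, (∫ x, ‖H (resOut p (glue p x y)) * condExp p T F (resOut p (glue p x y)) * weight T (glue p x y)‖)
        = |H y| * Real.exp (-(1/2 : ℝ) * (y ⬝ᵥ schurC p T *ᵥ y)) * (|condExp p T F y| * gaussNorm (blkIn p T)) := by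
      intro y
      have hpt : ∀ x, ‖H (resOut p (glue p x y)) * condExp p T F (resOut p (glue p x y)) * weight T (glue p x y)‖
          = (fun y' => |H y'| * |condExp p T F y'|) (resOut p (glue p x y)) * (fun _ : S → ℝ => (1 : ℝ)) (glue p x y) *
              weight T (glue p x y) := by
        intro x
        rw [Real.norm_eq_abs, abs_mul, abs_mul, abs_of_pos (weight_pos T _), resOut_glue, mul_one]
      simp_rw [hpt]
      rw [integral_section_eq p T hTs hdet (fun y' => |H y'| * |condExp p T F y'|) (fun _ => (1 : ℝ)) y]
      simp only [mul_one, gaussNorm]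
      ring
    have hclosedΦ : ∀ y, (∫ x, ‖H (resOut p (glue p x y)) * F (glue p x y) * weight T (glue p x y)‖)
        = |H y| * Real.exp (-(1/2 : ℝ) * (y ⬝ᵥ schurC p T *ᵥ y)) *
            gaussInt (blkIn p T) (fun z => |F (glue p (z + meanΛ p T y) y)|) := by
      intro y
      have hpt : ∀ x, ‖H (resOut p (glue p x y)) * F (glue p x y) * weight T (glue p x y)‖
          = (fun y' => |H y'|) (resOut p (glue p x y)) * (fun A => |F A|) (glue p x y) * weight T (glue p x y) := by
        intro x
        rw [Real.norm_eq_abs, abs_mul, abs_mul, abs_of_pos (weight_pos T _)]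
      simp_rw [hpt]
      rw [integral_section_eq p T hTs hdet (fun y' => |H y'|) (fun A => |F A|) y]
      simp only [gaussInt, smul_eq_mul]
    refine Integrable.mono' hdom ?_ (Filter.Eventually.of_forall fun y => ?_)
    · have hc : Measurable fun y => |H y| * Real.exp (-(1/2 : ℝ) * (y ⬝ᵥ schurC p T *ᵥ y)) *
          (|condExp p T F y| * gaussNorm (blkIn p T)) := by
        have hK : Measurable fun y : Out p → ℝ => Real.exp (-(1/2 : ℝ) * (y ⬝ᵥ schurC p T *ᵥ y)) := by
          refine Continuous.measurable ?_
          fun_prop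
        exact (hH.abs.mul hK).mul (hC.abs.mul_const _)
      exact hc.aestronglyMeasurable.congr (Filter.Eventually.of_forall fun y => (hclosed y).symm)
    · rw [Real.norm_eq_abs, abs_of_nonneg (integral_nonneg fun x => norm_nonneg _), hclosed y, hclosedΦ y]
      have h1 := abs_condExp_mul_gaussNorm_le p T F y hN
      have hK : 0 ≤ Real.exp (-(1/2 : ℝ) * (y ⬝ᵥ schurC p T *ᵥ y)) := (Real.exp_pos _).le
      exact mul_le_mul_of_nonneg_left h1 (mul_nonneg (abs_nonneg _) hK)

/-- **LEMMA 23, (320) as printed.** Let `S` be a finite set, `Λ ⊂ S`, `T` a positive (self-adjoint) operator on `R^S`,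
and let `H = H(A_{Λᶜ})`, `F = F(A)` be measurable with `H(A_{Λᶜ})F(A)e^{−½(A,TA)}` Lebesgue-integrable on `R^S`. Then
`∫_{R^S} H(A_{Λᶜ}) F(A) exp(−½(A,TA)) dA = ∫_{R^S} H(A_{Λᶜ}) F̃(A_{Λᶜ}) exp(−½(A,TA)) dA`
with `F̃(A_{Λᶜ}) = ∫_{R^Λ} F(A) dμ_{C_Λ,α_Λ}(A_Λ)` (321), `C_Λ = T_Λ⁻¹`, `α_Λ = −T_Λ⁻¹T_{ΛΛᶜ}A_{Λᶜ}` (`condExp`). Proof as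
printed: Fubini over `A = A_Λ ⊕ A_{Λᶜ}`, (322)∕(323) at fixed `A_{Λᶜ}` (`integral_section_eq_condExp`), and *"reverse the
first step"* (`integral_section_condExp_eq`); the right side converges absolutely by `integrable_rhs`.
[cite: Dimock2002QED3TorusI, App. C LEMMA 23 (320)–(323) p.65 L1–61] -/
theorem lemma23 (hT : T.PosDef) {H : (Out p → ℝ) → ℝ} {F : (S → ℝ) → ℝ} (hH : Measurable H) (hF : Measurable F)
    (hint : Integrable fun A : S → ℝ => H (resOut p A) * F A * weight T A) :
    ∫ A, H (resOut p A) * F A * weight T A = ∫ A, H (resOut p A) * condExp p T F (resOut p A) * weight T A := by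
  have hTs : T.IsSymm := isSymm_of_posDef T hT
  have hIn : (blkIn p T).PosDef := blkIn_posDef p T hT
  have hdet : IsUnit (blkIn p T).det := isUnit_iff_ne_zero.2 hIn.det_pos.ne'
  have hN : gaussNorm (blkIn p T) ≠ 0 := (gaussNorm_pos hIn).ne'
  -- the two integrands, read on pairs (A_Λ, A_{Λᶜ})
  set Φ : (In p → ℝ) × (Out p → ℝ) → ℝ :=
    fun q => H (resOut p (glue p q.1 q.2)) * F (glue p q.1 q.2) * weight T (glue p q.1 q.2) with hΦdef
  set Ψ : (In p → ℝ) × (Out p → ℝ) → ℝ :=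
    fun q => H (resOut p (glue p q.1 q.2)) * condExp p T F (resOut p (glue p q.1 q.2)) * weight T (glue p q.1 q.2)
    with hΨdef
  have eL : (∫ A, H (resOut p A) * F A * weight T A) = ∫ q, Φ q := integral_eq_integral_glue p _
  have eR : (∫ A, H (resOut p A) * condExp p T F (resOut p A) * weight T A) = ∫ q, Ψ q :=
    integral_eq_integral_glue p _
  have hΦ : Integrable Φ := (integrable_iff_integrable_glue p _).1 hint
  have hΨ : Integrable Ψ := integrable_rhs p T hT hH hF hΦ
  rw [eL, eR]
  calc ∫ q, Φ q = ∫ y, ∫ x, Φ (x, y) := integral_prod_symm Φ hΦ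
    _ = ∫ y, ∫ x, Ψ (x, y) := by
        refine integral_congr_ae (Filter.Eventually.of_forall fun y => ?_)
        show ∫ x, Φ (x, y) = ∫ x, Ψ (x, y)
        simp only [hΦdef, hΨdef]
        rw [integral_section_eq_condExp p T hTs hdet hN, integral_section_condExp_eq p T hTs hdet]
    _ = ∫ q, Ψ q := (integral_prod_symm Ψ hΨ).symm

/-- (320) with all hypotheses discharged for bounded measurable `H`, `F`.
[cite: Dimock2002QED3TorusI, App. C LEMMA 23 (320) p.65 L6–22] -/
theorem lemma23_of_bounded (hT : T.PosDef) {H : (Out p → ℝ) → ℝ} {F : (S → ℝ) → ℝ} (hH : Measurable H)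
    (hF : Measurable F) {CH CF : ℝ} (hbH : ∀ y, |H y| ≤ CH) (hbF : ∀ A, |F A| ≤ CF) :
    ∫ A, H (resOut p A) * F A * weight T A = ∫ A, H (resOut p A) * condExp p T F (resOut p A) * weight T A := by
  refine lemma23 p T hT hH hF ?_
  have hw : Integrable (weight T) := by
    have h := integrable_gaussWeight hT
    refine h.congr (Filter.Eventually.of_forall fun φ => ?_)
    rw [gaussWeight_eq, weight]
  have hm : AEStronglyMeasurable (fun A : S → ℝ => H (resOut p A) * F A) volume :=
    ((hH.comp (measurable_resOut p)).mul hF).aestronglyMeasurable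
  have hb : ∀ᵐ A : S → ℝ ∂volume, ‖H (resOut p A) * F A‖ ≤ CH * CF :=
    Filter.Eventually.of_forall fun A => by
      rw [norm_mul, Real.norm_eq_abs, Real.norm_eq_abs]
      exact mul_le_mul (hbH (resOut p A)) (hbF A) (abs_nonneg _) ((abs_nonneg (H (resOut p A))).trans (hbH _))
  exact (hw.bdd_mul hm hb).congr (Filter.Eventually.of_forall fun A => by ring)

/-- (320) with `H = 1`: `∫ F e^{−½(A,TA)} dA = ∫ F̃(A_{Λᶜ}) e^{−½(A,TA)} dA`. [cite: Dimock2002QED3TorusI, App. C LEMMA 23 (320) p.65 L6–22] -/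
theorem integral_mul_weight_eq_integral_condExp_mul_weight (hT : T.PosDef) {F : (S → ℝ) → ℝ} (hF : Measurable F)
    (hint : Integrable fun A : S → ℝ => F A * weight T A) :
    ∫ A, F A * weight T A = ∫ A, condExp p T F (resOut p A) * weight T A := by
  have h := lemma23 p T hT (H := fun _ => (1 : ℝ)) measurable_const hF (by simpa only [one_mul] using hint)
  simpa only [one_mul] using h

end Lemma23

end SpacetimeSplitBosons

end QED3TorusI

end Literature.MathematicalPhysics.QuantumFieldTheory.Dimock2011to13
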